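import Summits.QuantumFields.YangMills.Theorems.UnitScaleTiltProp7ComplementaryProjectorPointwiseDecayClosed
import HarnessLib

/-!
# Route `UnitScaleTilt`, crux K1 «MinimiserStabilityRegPr» (stmt-QuantumFields-19200), EX row `hPcol` — **P3v: THE SOURCE FORM OF PRINT'S COMPLEMENTARY GAUGE PROJECTOR.
# `(1 − R_{Q″}(U₀)) v = G_a(T c(v))` WITH A LIFTED COARSE SOURCE `T c(v)` OF SUP SIZE `≤ C′_src·sup‖v‖`, `C′_src` K-FREE** (LOCATE-hPcol v2 42098c54 §1–§2, 19200 evidence #54):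
# the `(1 − projR)` factor of `R_S G′ᴾ = projR ∘ G ∘ (1 − P₀)` is ABSORBED INTO THE SOURCE of the LOD propagator, so hPcol's one gradient letter falls on `D G_a` alone (T1).

Cell `ym3-torus` (HUMAN RULING D-0037; rung R3 = SU(2) YM₃ on T³ — NOT d = 4, NOT infinite volume, NOT a mass gap, NOT Clay).  Width seat `ym3-torus-px5` (gen 12).
THEOREMS ONLY (0 `def`, 0 `sorry`); `--supports stmt-QuantumFields-19200 --as helper`; count-neutral.

WHY.  routeR-w2's ✓`Prop7ComplementaryProjectorColumns.sub_projR_eq_gramSum` writes print's `P = 1 − R_{Q″}` as the Gram-inverse sum over the massive spike columns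
`ψ_i = G(T(b i))`: `v − projR v = Σ_i λ_i(v)•ψ_i`, `λ_i(v) = Σ_{i′} M⁻¹_{ii′}⟪ψ_{i′}, v⟫`.  By linearity this is `G(T(Σ_i λ_i(v)•b i))` — the LOD propagator applied to the LIFT of the coarse field
`c(v) := Σ_i λ_i(v)•b i` (§1).  The sup size of that source: `|⟪ψ_{i′}, v⟫| ≤ c₀(√c₁)⁻¹C_pt·ℓ³(2(1+1∕κ))³·sup‖v‖` (V5 ✓`norm_inner_spike_column_single_le` summed over the fine spikes of `v`, §2 —
the column VALUE decay `hcol` ⟸ V4 ✓p762742), `‖M⁻¹_{ii′}‖ ≤ C_N e^{−μ′·dc}` (B2c ✓`norm_gram_inv_spike_le_exp_neg_tdist`), `Σ_{i′} e^{−μ′·dc} ≤ 4(2(1+1∕μ′))³` (✓`sum_exp_neg_mul_dc_spike_le`) ⟹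
`sup_i|λ_i(v)| ≤ C_N·4(2(1+1∕μ′))³·c₀(√c₁)⁻¹C_pt ℓ³(2(1+1∕κ))³·sup‖v‖` (§3); the lift `T(b i)` lives in ONE block (✓`spike_column_source_eq_zero_off_block`) with
`‖(T(b i))(x)‖ ≤ (5∕4)·2√c₁·(√c₁)⁻¹√c₁∕(c₀ℓ³)` (V2b ✓`norm_equiv_column_source_le`, V5 ✓`norm_spikeEntry_le`) ⟹ `‖(T c(v))(x)‖ ≤ 4·A_T·sup|λ|` (§4).  The product
`A_T · c₀(√c₁)⁻¹ℓ³ = (5∕2)·(√c₁∕(c₀ℓ³))·(c₀ℓ³∕√c₁) = 5∕2` is K-FREE identically (no pin needed).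
WHAT IS PROVED (ns `Summit.QuantumFields.YangMills.Theorems.Prop7ComplementaryProjectorSourceForm`; V5's letters VERBATIM: `hseq hι hT ha hAG hGA`, B2c's `hδ₁ hδ hwin hCT hCTb hCG hGn hmB hcoer hgap`
at a Gram slope `μ′ > 0`, the column letter `hcol` at rate `κ > 0`).
* §1 `sum_exp_neg_mul_tdist_block_coarse_le`; ★ `sub_projR_eq_G_lift_coeffSum (hmB hcoer) (g) : g − projR Δ Q″ g = G (T (Σ_i λ_i(g) • b i))`.
* §2 ★ `norm_inner_spike_column_le_of_sup (hcol) (i) (v) (hv : ∀ x, ‖v(x)‖_{W₂} ≤ Vb) : ‖⟪G(T(b i)), v⟫‖ ≤ c₀(√c₁)⁻¹C_pt·(ℓ³(2(1+1∕κ))³)·Vb`.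
* §3 ★★ `norm_coeff_le_of_sup … (i) : ‖λ_i(v)‖ ≤ C_N·4(2(1+1∕μ′))³·(c₀(√c₁)⁻¹C_pt ℓ³(2(1+1∕κ))³ Vb)`.
* §4 ★★ `norm_equiv_lift_coeffSum_apply_le (coef) (hcoef : ∀ i, ‖coef i‖ ≤ Cc) (x) : ‖(T(Σ_i coef i • b i))(x)‖_{W₂} ≤ 4·A_T·Cc`, `A_T = (5∕4)√(2c₁)ℓ⁻³∕c₀·(√(2c₁)(√c₁)⁻¹)`.
* §5 ★★★ `norm_equiv_complementary_source_apply_le … (v) (hv) (x) : ‖(T c(v))(x)‖_{W₂} ≤ 4·A_T·C_N·4(2(1+1∕μ′))³·c₀(√c₁)⁻¹C_pt ℓ³(2(1+1∕κ))³·Vb` — with §1: `(1 − projR)v = G(T c(v))`, source K-FREE.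
HYP-SAT (★★OWNER RULING №42): every hypothesis is a letter of V5∕V5b VERBATIM — `RegPr` (member class), `hseq hι hT hAG hGA` (LOD letters ⟸ ✓`exists_intertwiner_of_regPr`, ✓`exists_massive_inverse`),
B2c's window∕gap (⟸ routeR-w4 `window_delta`∕`window_win`, routeR-w2 `coarseCoercivity_pos`), `hcol` (⟸ V4 ✓`norm_equiv_massiveColumn_apply_le_decay`), `hv` = data; nothing eventual; conclusions non-vacuous.
HONEST SCOPE.  VALUE-class bookkeeping; nothing of T1 (the gradient letter), `hPcol`, the ten EX rows, `hT`, `hGF`, EX `stub_existenceMinimalOrbit` or the crux is proved here; the Yang–Mills mass gap is NOT proved.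

References: T. Bałaban, CMP **99** (1985) 389–434 [Balaban1985BackgroundPropagators] ((3.11) p.392, (3.16) p.393, (3.21)–(3.25) p.394, Thm 3.1 (3.42)∕(3.46) pp.397–398, (3.49) p.399);
CMP **102** (1985) 277–309 [Balaban1985Variational] ((139) p.299); T. Bałaban, CMP **116** (1988) 1–22 [Balaban1988RG2Cluster] ((2.7) p.13).
-/

set_option autoImplicit false

noncomputable section

open scoped BigOperators Matrix.Norms.L2Operator InnerProductSpace ComplexConjugate Matrix

namespace Summit.QuantumFields.YangMills.Theorems.Prop7ComplementaryProjectorSourceForm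

open Literature.MathematicalPhysics.QuantumFieldTheory.Balaban1983to89
open Finset
open T4Continuum BlockAveraging
open BlockAveraging (Idx)
open B7Prop1Explicit (U1 disp)
open B5Eq118OneStroke (iterBlockOf iterBlock mem_iterBlock card_iterBlock)
open B10Eq27TorusAxialLog (holT transl)
open B7TransferAnalyticMean (meanCLM)
open B4Sect5Torus (TSite)
open B9Eq311L2Pairing (WL2)
open B11Eq103H1Complex (SiteL2K BondL2K projR)
open Summit.QuantumFields.YangMills.Theorems.Prop8Chart (emlIterU)
open Literature.MathematicalPhysics.QuantumFieldTheory.Balaban1983to89.T3ContinuumYM3Torus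
open T3SectALandauChart (eta eta_pos bgUnits)
open T3PrintedRegularMinimiser (RegPr)
open T3PrintedRegularOrbits (sites_eq)
open T3LevelShift (siteShift)
open Summit.QuantumFields.YangMills.Theorems.Prop7SectET3Transport (periodsT3 siteEquiv)
open Summit.QuantumFields.YangMills.Theorems.Prop7SectET3HilbertLetters (W₂ frobEquiv toL2 toL2S DL2 DstarL2 covLapSite toL2S_apply toL2S_symm_apply inner_frobEquiv_symm)
open Summit.QuantumFields.YangMills.Theorems.Prop7SiteEntryCoordinates (orthonormal_spike top_le_span_spike)
open Summit.QuantumFields.YangMills.Theorems.Prop7BlockBumpExtension (sum_comp_iterBlockOf)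
open Summit.QuantumFields.YangMills.Theorems.Prop7BlockDistanceWeights (sum_exp_neg_mul_tdist_coarse_le tdist_coarse_comm)
open Summit.QuantumFields.YangMills.Theorems.Prop7ComplementaryProjectorColumns (isUnit_gram_massive_columns sub_projR_eq_gramSum)
open Summit.QuantumFields.YangMills.Theorems.Prop7CoarseGramInverseDecay (spike_eq_lift norm_gram_inv_spike_le_exp_neg_tdist)
open Summit.QuantumFields.YangMills.Theorems.Prop7ComplementaryProjectorBlockDecay (sum_exp_neg_mul_dc_spike_le spike_column_source_eq_zero_off_block)
open Summit.QuantumFields.YangMills.Theorems.Prop7ComplementaryProjectorPointwiseDecay (norm_spikeEntry_le norm_inner_spike_column_single_le)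
open Summit.QuantumFields.YangMills.Theorems.Prop7MassiveColumnSupBound (norm_equiv_column_source_le)

variable (F : T3Family) {n K : ℕ} (h : n ≤ K) {c₀ c₁ : ℝ} [Fact (0 < c₀)] [Fact (0 < c₁)]
  {ε₀ : ℝ} (hε₀ : 0 < ε₀) (hε7 : 10 ^ 7 * (F.L : ℝ) ^ 3 * ε₀ ≤ 1)
  (U₀ : GaugeField (F.P K) 0 (Matrix.specialUnitaryGroup (Fin 2) ℂ)) (hreg : RegPr F n K ε₀ U₀)
  (Q'' : SiteL2K ℂ 3 (periodsT3 F K) c₀ W₂ →ₗ[ℂ] (Site (F.P K) (K - n) → Matrix (Fin 2) (Fin 2) ℂ))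
  (hseq : ∀ lam : Site (F.P K) 0 → Matrix (Fin 2) (Fin 2) ℂ, ∃ ns : (j : ℕ) → Site (F.P K) j → Matrix (Fin 2) (Fin 2) ℂ, ns 0 = lam ∧
      (∀ (j : ℕ) (y : Site (F.P K) (j + 1)), ns (j + 1) y = ns j (emb y) - meanCLM (Idx (F.P K)) (Matrix (Fin 2) (Fin 2) ℂ) fun i : Idx (F.P K) =>
        ns j (emb y) - ((holT (emlIterU j (bgUnits F K U₀)) (emb y) (stairWord i.2.1 (off i.1)) : (Matrix (Fin 2) (Fin 2) ℂ)ˣ) : Matrix (Fin 2) (Fin 2) ℂ) *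
          ns j (transl (emb y) (disp (stairWord i.2.1 (off i.1)))) * (((holT (emlIterU j (bgUnits F K U₀)) (emb y) (stairWord i.2.1 (off i.1)))⁻¹ : (Matrix (Fin 2) (Fin 2) ℂ)ˣ) : Matrix (Fin 2) (Fin 2) ℂ)) ∧
      ns (K - n) = Q'' (toL2S F K c₀ lam))
  (ι : (Site (F.P K) (K - n) → Matrix (Fin 2) (Fin 2) ℂ) →ₗ[ℂ] SiteL2K ℂ 3 (periodsT3 F n) c₁ W₂)
  (hι : ∀ c, ι c = toL2S F n c₁ (fun z => c (siteShift (sites_eq F n K h) z)))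
  (T : SiteL2K ℂ 3 (periodsT3 F n) c₁ W₂ →ₗ[ℂ] SiteL2K ℂ 3 (periodsT3 F K) c₀ W₂)
  (hT : ∀ (l : SiteL2K ℂ 3 (periodsT3 F K) c₀ W₂) (f : SiteL2K ℂ 3 (periodsT3 F n) c₁ W₂), ⟪ι (Q'' l), f⟫_ℂ = ⟪l, T f⟫_ℂ)
  {a : ℝ} (ha : 0 < a)
  (G : SiteL2K ℂ 3 (periodsT3 F K) c₀ W₂ →ₗ[ℂ] SiteL2K ℂ 3 (periodsT3 F K) c₀ W₂)
  (hAG : ∀ f, covLapSite F n K c₀ U₀ (G f) + (a : ℂ) • T (ι (Q'' (G f))) = f)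
  (hGA : ∀ u, G (covLapSite F n K c₀ U₀ u + (a : ℂ) • T (ι (Q'' u))) = u)

/-! ## §1 A fine sum against a coarse centre; the source form of `1 − projR` -/

/-- `Σ_{x : fine} e^{−κ·tdist(B x, y)} ≤ (L^d)^{K−n}·(2(1+1∕κ))³` (✓`sum_comp_iterBlockOf` + px12 ✓`sum_exp_neg_mul_tdist_coarse_le`). [cite: Balaban1988RG2Cluster, (2.7) p.13] -/
theorem sum_exp_neg_mul_tdist_block_coarse_le {κ : ℝ} (hκ : 0 < κ) (y : Site (F.P K) (K - n)) :
    ∑ x : Site (F.P K) 0, Real.exp (-(κ * (Site.tdist (P := F.P K) (iterBlockOf (K - n) x) y : ℝ)))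
      ≤ ((((F.P K).L : ℝ) ^ (F.P K).d) ^ (K - n)) * (2 * (1 + 1 / κ)) ^ 3 := by
  have hk : K - n ≤ (F.P K).m + (F.P K).K := by show K - n ≤ F.m + K; have := F.hm; omega
  rw [sum_comp_iterBlockOf hk (fun z : Site (F.P K) (K - n) => Real.exp (-(κ * (Site.tdist (P := F.P K) z y : ℝ))))]
  refine mul_le_mul_of_nonneg_left ?_ (by have := (F.P K).L_pos; positivity)
  exact sum_exp_neg_mul_tdist_coarse_le F hκ _

include hι hT hAG hGA in
/-- ★ **`(1 − projR Δ_{U₀} Q″) g = G(T(Σ_i λ_i(g) • b i))`** — routeR-w2 ✓`sub_projR_eq_gramSum` (Gram-inverse sum over the massive spike columns, `M` invertible by ✓`isUnit_gram_massive_columns` from the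
coarse coercivity `m_B‖f‖ ≤ ‖G(Tf)‖`) and linearity of `G ∘ T`: print's complementary projector is the LOD propagator on a LIFTED COARSE SOURCE. [cite: Balaban1985BackgroundPropagators, (3.21)–(3.25) p.394, (3.49) p.399] -/
theorem sub_projR_eq_G_lift_coeffSum {mB : ℝ} (hmB : 0 < mB) (hcoer : ∀ f : SiteL2K ℂ 3 (periodsT3 F n) c₁ W₂, mB * ‖f‖ ≤ ‖G (T f)‖)
    (g : SiteL2K ℂ 3 (periodsT3 F K) c₀ W₂) :
    g - projR (covLapSite F n K c₀ U₀) Q'' g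
      = G (T (∑ i, (∑ i', (Matrix.of fun i i' : Site (F.P n) 0 × (Fin 2 × Fin 2) => ⟪G (T ((OrthonormalBasis.mk (orthonormal_spike F) (top_le_span_spike F) : OrthonormalBasis (Site (F.P n) 0 × (Fin 2 × Fin 2)) ℂ (SiteL2K ℂ 3 (periodsT3 F n) c₁ W₂)) i)), G (T ((OrthonormalBasis.mk (orthonormal_spike F) (top_le_span_spike F) : OrthonormalBasis (Site (F.P n) 0 × (Fin 2 × Fin 2)) ℂ (SiteL2K ℂ 3 (periodsT3 F n) c₁ W₂)) i'))⟫_ℂ)⁻¹ i i' * ⟪G (T ((OrthonormalBasis.mk (orthonormal_spike F) (top_le_span_spike F) : OrthonormalBasis (Site (F.P n) 0 × (Fin 2 × Fin 2)) ℂ (SiteL2K ℂ 3 (periodsT3 F n) c₁ W₂)) i')), g⟫_ℂ) • (OrthonormalBasis.mk (orthonormal_spike F) (top_le_span_spike F) : OrthonormalBasis (Site (F.P n) 0 × (Fin 2 × Fin 2)) ℂ (SiteL2K ℂ 3 (periodsT3 F n) c₁ W₂)) i)) := by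
  have hunit := isUnit_gram_massive_columns F T G (OrthonormalBasis.mk (orthonormal_spike F) (top_le_span_spike F) : OrthonormalBasis (Site (F.P n) 0 × (Fin 2 × Fin 2)) ℂ (SiteL2K ℂ 3 (periodsT3 F n) c₁ W₂)) hmB hcoer
  rw [sub_projR_eq_gramSum F h U₀ Q'' ι hι T hT G hAG hGA (OrthonormalBasis.mk (orthonormal_spike F) (top_le_span_spike F) : OrthonormalBasis (Site (F.P n) 0 × (Fin 2 × Fin 2)) ℂ (SiteL2K ℂ 3 (periodsT3 F n) c₁ W₂)) hunit g, map_sum, map_sum]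
  simp only [map_smul]

/-! ## §2 A spike column against a bounded field -/

include hι in
/-- ★ **A SPIKE COLUMN PAIRS WITH A BOUNDED FIELD AT SIZE `c₀(√c₁)⁻¹C_pt·ℓ³(2(1+1∕κ))³·sup‖v‖`**: decompose `v = Σ_x toL2S(δ_x ⊗ v(x))`, apply V5 ✓`norm_inner_spike_column_single_le` per spike and sum the
column's pointwise decay over the fine sites (§1). [cite: Balaban1985BackgroundPropagators, (3.11) p.392, Thm 3.1 (3.42) p.397; Balaban1988RG2Cluster, (2.7) p.13] -/
theorem norm_inner_spike_column_le_of_sup {Cpt κ : ℝ} (hCpt : 0 ≤ Cpt) (hκ : 0 < κ)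
    (hcol : ∀ (y : Site (F.P K) (K - n)) (Y : Matrix (Fin 2) (Fin 2) ℂ) (x : Site (F.P K) 0),
      ‖WL2.equiv ℂ _ W₂ (G (T (ι (Pi.single y Y)))) (siteEquiv F K x)‖ ≤ Cpt * Real.exp (-(κ * (Site.tdist (P := F.P K) (iterBlockOf (K - n) x) y : ℝ))) * ‖Y‖)
    (i : Site (F.P n) 0 × (Fin 2 × Fin 2)) (v : SiteL2K ℂ 3 (periodsT3 F K) c₀ W₂) {Vb : ℝ}
    (hv : ∀ x : Site (F.P K) 0, ‖WL2.equiv ℂ _ W₂ v (siteEquiv F K x)‖ ≤ Vb) :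
    ‖⟪G (T ((OrthonormalBasis.mk (orthonormal_spike F) (top_le_span_spike F) : OrthonormalBasis (Site (F.P n) 0 × (Fin 2 × Fin 2)) ℂ (SiteL2K ℂ 3 (periodsT3 F n) c₁ W₂)) i)), v⟫_ℂ‖ ≤ (c₀ * (Real.sqrt c₁)⁻¹ * Cpt * (((((F.P K).L : ℝ) ^ (F.P K).d) ^ (K - n)) * (2 * (1 + 1 / κ)) ^ 3) * Vb) := by
  classical
  have hc₀ : 0 < c₀ := Fact.out
  have hVb : 0 ≤ Vb := (norm_nonneg _).trans (hv 0)
  -- decompose `v` into fine spikes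
  have hdec : v = ∑ x : Site (F.P K) 0, toL2S F K c₀ (Pi.single x ((toL2S F K c₀).symm v x)) := by
    conv_lhs => rw [← (toL2S F K c₀).apply_symm_apply v, ← Finset.univ_sum_single ((toL2S F K c₀).symm v)]
    rw [map_sum]
  have hread : ∀ x : Site (F.P K) 0, ‖(frobEquiv.symm ((toL2S F K c₀).symm v x) : W₂)‖ = ‖WL2.equiv ℂ _ W₂ v (siteEquiv F K x)‖ := fun x => by
    rw [toL2S_symm_apply, LinearEquiv.symm_apply_apply]
  rw [hdec, inner_sum]
  refine (norm_sum_le _ _).trans ?_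
  have hterm : ∀ x : Site (F.P K) 0, ‖⟪G (T ((OrthonormalBasis.mk (orthonormal_spike F) (top_le_span_spike F) : OrthonormalBasis (Site (F.P n) 0 × (Fin 2 × Fin 2)) ℂ (SiteL2K ℂ 3 (periodsT3 F n) c₁ W₂)) i)), toL2S F K c₀ (Pi.single x ((toL2S F K c₀).symm v x))⟫_ℂ‖
      ≤ (c₀ * (Real.sqrt c₁)⁻¹ * Cpt * Vb) * Real.exp (-(κ * (Site.tdist (P := F.P K) (iterBlockOf (K - n) x) (siteShift (sites_eq F n K h) i.1) : ℝ))) := by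
    intro x
    refine (norm_inner_spike_column_single_le F h ι hι T G hCpt hcol i x _).trans ?_
    rw [hread x]
    have hA : 0 ≤ c₀ * (Real.sqrt c₁)⁻¹ * Cpt := by positivity
    have he : 0 ≤ Real.exp (-(κ * (Site.tdist (P := F.P K) (iterBlockOf (K - n) x) (siteShift (sites_eq F n K h) i.1) : ℝ))) := (Real.exp_pos _).le
    calc c₀ * (Real.sqrt c₁)⁻¹ * Cpt * ‖WL2.equiv ℂ _ W₂ v (siteEquiv F K x)‖ * Real.exp (-(κ * (Site.tdist (P := F.P K) (iterBlockOf (K - n) x) (siteShift (sites_eq F n K h) i.1) : ℝ)))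
        ≤ c₀ * (Real.sqrt c₁)⁻¹ * Cpt * Vb * Real.exp (-(κ * (Site.tdist (P := F.P K) (iterBlockOf (K - n) x) (siteShift (sites_eq F n K h) i.1) : ℝ))) :=
          mul_le_mul_of_nonneg_right (mul_le_mul_of_nonneg_left (hv x) hA) he
      _ = _ := by ring
  refine (Finset.sum_le_sum fun x _ => hterm x).trans ?_
  rw [← Finset.mul_sum]
  have hS := sum_exp_neg_mul_tdist_block_coarse_le F (n := n) hκ (siteShift (sites_eq F n K h) i.1)
  have hA : 0 ≤ c₀ * (Real.sqrt c₁)⁻¹ * Cpt * Vb := by positivity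
  calc (c₀ * (Real.sqrt c₁)⁻¹ * Cpt * Vb) * ∑ x : Site (F.P K) 0, Real.exp (-(κ * (Site.tdist (P := F.P K) (iterBlockOf (K - n) x) (siteShift (sites_eq F n K h) i.1) : ℝ)))
      ≤ (c₀ * (Real.sqrt c₁)⁻¹ * Cpt * Vb) * (((((F.P K).L : ℝ) ^ (F.P K).d) ^ (K - n)) * (2 * (1 + 1 / κ)) ^ 3) := mul_le_mul_of_nonneg_left hS hA
    _ = _ := by ring

/-! ## §3 The Gram coefficients `λ_i(v)` are uniformly small -/

include hε₀ hε7 hreg hseq hι hT ha hAG in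
/-- ★★ **THE GRAM COEFFICIENTS OF A BOUNDED FIELD**: `|λ_i(v)| = |Σ_{i′} M⁻¹_{ii′}⟪G(T(b i′)), v⟫| ≤ C_N(μ′)·4(2(1+1∕μ′))³·c₀(√c₁)⁻¹C_pt·ℓ³(2(1+1∕κ))³·sup‖v‖` — B2c ✓`norm_gram_inv_spike_le_exp_neg_tdist`
(`‖M⁻¹_{ii′}‖ ≤ C_N e^{−μ′·dc}`), §2, ✓`sum_exp_neg_mul_dc_spike_le`. [cite: Balaban1985BackgroundPropagators, Thm 3.1 (3.46) p.398, (3.49) p.399; Balaban1988RG2Cluster, (2.7) p.13] -/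
theorem norm_coeff_le_of_sup {μ' : ℝ} (hμ' : 0 < μ')
    {δ₁ : ℝ} (hδ₁ : 0 ≤ δ₁)
    (hδ : 3 * ((eta F n K)⁻¹) ^ 2 * (Real.exp (μ' * eta F n K) - 1) ^ 2 + a * ((25 / 8) * (c₁ * ((((F.P K).L : ℝ) ^ (F.P K).d) ^ (K - n))⁻¹ / c₀)) * (Real.exp (3 * μ') - 1) ^ 2 ≤ δ₁ ^ 2)
    (hwin : Real.sqrt (max 2 (16 * c₀ * ((F.L : ℝ) ^ (K - n)) ^ 3 / (a * c₁))) * δ₁ ≤ 1 / 10)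
    {CT : ℝ} (hCT : 0 ≤ CT) (hCTb : ∀ l : SiteL2K ℂ 3 (periodsT3 F K) c₀ W₂, ‖ι (Q'' l)‖ ≤ CT * ‖l‖)
    {CG : ℝ} (hCG : 0 ≤ CG) (hGn : ∀ f, ‖G f‖ ≤ CG * ‖f‖)
    {mB : ℝ} (hmB : 0 < mB) (hcoer : ∀ f : SiteL2K ℂ 3 (periodsT3 F n) c₁ W₂, mB * ‖f‖ ≤ ‖G (T f)‖)
    (hgap : 3 * ((Real.sqrt (max 2 (16 * c₀ * ((F.L : ℝ) ^ (K - n)) ^ 3 / (a * c₁))) * (2 + Real.sqrt (max 2 (16 * c₀ * ((F.L : ℝ) ^ (K - n)) ^ 3 / (a * c₁)))))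
          * (Real.sqrt 3 * (eta F n K)⁻¹ * (Real.exp (μ' * eta F n K) - 1) + (Real.sqrt 3 * (eta F n K)⁻¹ * (Real.exp (μ' * eta F n K) - 1)) ^ 2 + Real.sqrt a * CT * (Real.exp (3 * μ') - 1) + a * CT ^ 2 * (Real.exp (3 * μ') - 1) ^ 2)
          * (8 * Real.sqrt (max 2 (16 * c₀ * ((F.L : ℝ) ^ (K - n)) ^ 3 / (a * c₁))) + 8 * Real.sqrt (max 2 (16 * c₀ * ((F.L : ℝ) ^ (K - n)) ^ 3 / (a * c₁))) ^ 2)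
          * (CT * (1 + (Real.exp (3 * μ') - 1))) + CG * (CT * (Real.exp (3 * μ') - 1))) ^ 2 < mB ^ 2 / 2)
    {Cpt κ : ℝ} (hCpt : 0 ≤ Cpt) (hκ : 0 < κ)
    (hcol : ∀ (y : Site (F.P K) (K - n)) (Y : Matrix (Fin 2) (Fin 2) ℂ) (x : Site (F.P K) 0),
      ‖WL2.equiv ℂ _ W₂ (G (T (ι (Pi.single y Y)))) (siteEquiv F K x)‖ ≤ Cpt * Real.exp (-(κ * (Site.tdist (P := F.P K) (iterBlockOf (K - n) x) y : ℝ))) * ‖Y‖)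
    (v : SiteL2K ℂ 3 (periodsT3 F K) c₀ W₂) {Vb : ℝ} (hv : ∀ x : Site (F.P K) 0, ‖WL2.equiv ℂ _ W₂ v (siteEquiv F K x)‖ ≤ Vb)
    (i : Site (F.P n) 0 × (Fin 2 × Fin 2)) :
    ‖(∑ i', (Matrix.of fun i i' : Site (F.P n) 0 × (Fin 2 × Fin 2) => ⟪G (T ((OrthonormalBasis.mk (orthonormal_spike F) (top_le_span_spike F) : OrthonormalBasis (Site (F.P n) 0 × (Fin 2 × Fin 2)) ℂ (SiteL2K ℂ 3 (periodsT3 F n) c₁ W₂)) i)), G (T ((OrthonormalBasis.mk (orthonormal_spike F) (top_le_span_spike F) : OrthonormalBasis (Site (F.P n) 0 × (Fin 2 × Fin 2)) ℂ (SiteL2K ℂ 3 (periodsT3 F n) c₁ W₂)) i'))⟫_ℂ)⁻¹ i i' * ⟪G (T ((OrthonormalBasis.mk (orthonormal_spike F) (top_le_span_spike F) : OrthonormalBasis (Site (F.P n) 0 × (Fin 2 × Fin 2)) ℂ (SiteL2K ℂ 3 (periodsT3 F n) c₁ W₂)) i')), v⟫_ℂ)‖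
      ≤ ((mB ^ 2 / 2 - 3 * ((Real.sqrt (max 2 (16 * c₀ * ((F.L : ℝ) ^ (K - n)) ^ 3 / (a * c₁))) * (2 + Real.sqrt (max 2 (16 * c₀ * ((F.L : ℝ) ^ (K - n)) ^ 3 / (a * c₁)))))
          * (Real.sqrt 3 * (eta F n K)⁻¹ * (Real.exp (μ' * eta F n K) - 1) + (Real.sqrt 3 * (eta F n K)⁻¹ * (Real.exp (μ' * eta F n K) - 1)) ^ 2 + Real.sqrt a * CT * (Real.exp (3 * μ') - 1) + a * CT ^ 2 * (Real.exp (3 * μ') - 1) ^ 2)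
          * (8 * Real.sqrt (max 2 (16 * c₀ * ((F.L : ℝ) ^ (K - n)) ^ 3 / (a * c₁))) + 8 * Real.sqrt (max 2 (16 * c₀ * ((F.L : ℝ) ^ (K - n)) ^ 3 / (a * c₁))) ^ 2)
          * (CT * (1 + (Real.exp (3 * μ') - 1))) + CG * (CT * (Real.exp (3 * μ') - 1))) ^ 2)⁻¹ * Real.exp (9 * μ')) * (4 * (2 * (1 + 1 / μ')) ^ 3) * (c₀ * (Real.sqrt c₁)⁻¹ * Cpt * (((((F.P K).L : ℝ) ^ (F.P K).d) ^ (K - n)) * (2 * (1 + 1 / κ)) ^ 3) * Vb) := by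
  classical
  have hB : ∀ i', ‖⟪G (T ((OrthonormalBasis.mk (orthonormal_spike F) (top_le_span_spike F) : OrthonormalBasis (Site (F.P n) 0 × (Fin 2 × Fin 2)) ℂ (SiteL2K ℂ 3 (periodsT3 F n) c₁ W₂)) i')), v⟫_ℂ‖ ≤ (c₀ * (Real.sqrt c₁)⁻¹ * Cpt * (((((F.P K).L : ℝ) ^ (F.P K).d) ^ (K - n)) * (2 * (1 + 1 / κ)) ^ 3) * Vb) := fun i' => norm_inner_spike_column_le_of_sup F h ι hι T G hCpt hκ hcol i' v hv
  have hB0 : 0 ≤ (c₀ * (Real.sqrt c₁)⁻¹ * Cpt * (((((F.P K).L : ℝ) ^ (F.P K).d) ^ (K - n)) * (2 * (1 + 1 / κ)) ^ 3) * Vb) := (norm_nonneg _).trans (hB i)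
  have hCN0 : 0 ≤ ((mB ^ 2 / 2 - 3 * ((Real.sqrt (max 2 (16 * c₀ * ((F.L : ℝ) ^ (K - n)) ^ 3 / (a * c₁))) * (2 + Real.sqrt (max 2 (16 * c₀ * ((F.L : ℝ) ^ (K - n)) ^ 3 / (a * c₁)))))
          * (Real.sqrt 3 * (eta F n K)⁻¹ * (Real.exp (μ' * eta F n K) - 1) + (Real.sqrt 3 * (eta F n K)⁻¹ * (Real.exp (μ' * eta F n K) - 1)) ^ 2 + Real.sqrt a * CT * (Real.exp (3 * μ') - 1) + a * CT ^ 2 * (Real.exp (3 * μ') - 1) ^ 2)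
          * (8 * Real.sqrt (max 2 (16 * c₀ * ((F.L : ℝ) ^ (K - n)) ^ 3 / (a * c₁))) + 8 * Real.sqrt (max 2 (16 * c₀ * ((F.L : ℝ) ^ (K - n)) ^ 3 / (a * c₁))) ^ 2)
          * (CT * (1 + (Real.exp (3 * μ') - 1))) + CG * (CT * (Real.exp (3 * μ') - 1))) ^ 2)⁻¹ * Real.exp (9 * μ')) := mul_nonneg (inv_pos.2 (sub_pos.2 hgap)).le (Real.exp_pos _).le
  have hN := fun i' => norm_gram_inv_spike_le_exp_neg_tdist F h hε₀ hε7 U₀ hreg Q'' hseq ι hι T hT ha G hAG hμ'.le hδ₁ hδ hwin hCT hCTb hCG hGn hmB hcoer hgap i i'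
  refine (norm_sum_le _ _).trans ?_
  have hterm : ∀ i' : Site (F.P n) 0 × (Fin 2 × Fin 2), ‖(Matrix.of fun i i' : Site (F.P n) 0 × (Fin 2 × Fin 2) => ⟪G (T ((OrthonormalBasis.mk (orthonormal_spike F) (top_le_span_spike F) : OrthonormalBasis (Site (F.P n) 0 × (Fin 2 × Fin 2)) ℂ (SiteL2K ℂ 3 (periodsT3 F n) c₁ W₂)) i)), G (T ((OrthonormalBasis.mk (orthonormal_spike F) (top_le_span_spike F) : OrthonormalBasis (Site (F.P n) 0 × (Fin 2 × Fin 2)) ℂ (SiteL2K ℂ 3 (periodsT3 F n) c₁ W₂)) i'))⟫_ℂ)⁻¹ i i' * ⟪G (T ((OrthonormalBasis.mk (orthonormal_spike F) (top_le_span_spike F) : OrthonormalBasis (Site (F.P n) 0 × (Fin 2 × Fin 2)) ℂ (SiteL2K ℂ 3 (periodsT3 F n) c₁ W₂)) i')), v⟫_ℂ‖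
      ≤ (((mB ^ 2 / 2 - 3 * ((Real.sqrt (max 2 (16 * c₀ * ((F.L : ℝ) ^ (K - n)) ^ 3 / (a * c₁))) * (2 + Real.sqrt (max 2 (16 * c₀ * ((F.L : ℝ) ^ (K - n)) ^ 3 / (a * c₁)))))
          * (Real.sqrt 3 * (eta F n K)⁻¹ * (Real.exp (μ' * eta F n K) - 1) + (Real.sqrt 3 * (eta F n K)⁻¹ * (Real.exp (μ' * eta F n K) - 1)) ^ 2 + Real.sqrt a * CT * (Real.exp (3 * μ') - 1) + a * CT ^ 2 * (Real.exp (3 * μ') - 1) ^ 2)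
          * (8 * Real.sqrt (max 2 (16 * c₀ * ((F.L : ℝ) ^ (K - n)) ^ 3 / (a * c₁))) + 8 * Real.sqrt (max 2 (16 * c₀ * ((F.L : ℝ) ^ (K - n)) ^ 3 / (a * c₁))) ^ 2)
          * (CT * (1 + (Real.exp (3 * μ') - 1))) + CG * (CT * (Real.exp (3 * μ') - 1))) ^ 2)⁻¹ * Real.exp (9 * μ')) * (c₀ * (Real.sqrt c₁)⁻¹ * Cpt * (((((F.P K).L : ℝ) ^ (F.P K).d) ^ (K - n)) * (2 * (1 + 1 / κ)) ^ 3) * Vb)) * Real.exp (-(μ' * (Site.tdist (P := F.P K) (siteShift (sites_eq F n K h) i.1) (siteShift (sites_eq F n K h) i'.1) : ℝ))) := by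
    intro i'
    rw [norm_mul]
    calc ‖(Matrix.of fun i i' : Site (F.P n) 0 × (Fin 2 × Fin 2) => ⟪G (T ((OrthonormalBasis.mk (orthonormal_spike F) (top_le_span_spike F) : OrthonormalBasis (Site (F.P n) 0 × (Fin 2 × Fin 2)) ℂ (SiteL2K ℂ 3 (periodsT3 F n) c₁ W₂)) i)), G (T ((OrthonormalBasis.mk (orthonormal_spike F) (top_le_span_spike F) : OrthonormalBasis (Site (F.P n) 0 × (Fin 2 × Fin 2)) ℂ (SiteL2K ℂ 3 (periodsT3 F n) c₁ W₂)) i'))⟫_ℂ)⁻¹ i i'‖ * ‖⟪G (T ((OrthonormalBasis.mk (orthonormal_spike F) (top_le_span_spike F) : OrthonormalBasis (Site (F.P n) 0 × (Fin 2 × Fin 2)) ℂ (SiteL2K ℂ 3 (periodsT3 F n) c₁ W₂)) i')), v⟫_ℂ‖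
        ≤ (((mB ^ 2 / 2 - 3 * ((Real.sqrt (max 2 (16 * c₀ * ((F.L : ℝ) ^ (K - n)) ^ 3 / (a * c₁))) * (2 + Real.sqrt (max 2 (16 * c₀ * ((F.L : ℝ) ^ (K - n)) ^ 3 / (a * c₁)))))
          * (Real.sqrt 3 * (eta F n K)⁻¹ * (Real.exp (μ' * eta F n K) - 1) + (Real.sqrt 3 * (eta F n K)⁻¹ * (Real.exp (μ' * eta F n K) - 1)) ^ 2 + Real.sqrt a * CT * (Real.exp (3 * μ') - 1) + a * CT ^ 2 * (Real.exp (3 * μ') - 1) ^ 2)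
          * (8 * Real.sqrt (max 2 (16 * c₀ * ((F.L : ℝ) ^ (K - n)) ^ 3 / (a * c₁))) + 8 * Real.sqrt (max 2 (16 * c₀ * ((F.L : ℝ) ^ (K - n)) ^ 3 / (a * c₁))) ^ 2)
          * (CT * (1 + (Real.exp (3 * μ') - 1))) + CG * (CT * (Real.exp (3 * μ') - 1))) ^ 2)⁻¹ * Real.exp (9 * μ')) * Real.exp (-(μ' * (Site.tdist (P := F.P K) (siteShift (sites_eq F n K h) i.1) (siteShift (sites_eq F n K h) i'.1) : ℝ)))) * (c₀ * (Real.sqrt c₁)⁻¹ * Cpt * (((((F.P K).L : ℝ) ^ (F.P K).d) ^ (K - n)) * (2 * (1 + 1 / κ)) ^ 3) * Vb) :=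
          mul_le_mul (hN i') (hB i') (norm_nonneg _) (mul_nonneg hCN0 (Real.exp_pos _).le)
      _ = _ := by ring
  refine (Finset.sum_le_sum fun i' _ => hterm i').trans ?_
  rw [← Finset.mul_sum]
  have hS : ∑ i' : Site (F.P n) 0 × (Fin 2 × Fin 2), Real.exp (-(μ' * (Site.tdist (P := F.P K) (siteShift (sites_eq F n K h) i.1) (siteShift (sites_eq F n K h) i'.1) : ℝ)))
      ≤ 4 * (2 * (1 + 1 / μ')) ^ 3 := by
    rw [Finset.sum_congr rfl fun i' _ => by rw [tdist_coarse_comm F]]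
    exact sum_exp_neg_mul_dc_spike_le F h hμ' i
  calc (((mB ^ 2 / 2 - 3 * ((Real.sqrt (max 2 (16 * c₀ * ((F.L : ℝ) ^ (K - n)) ^ 3 / (a * c₁))) * (2 + Real.sqrt (max 2 (16 * c₀ * ((F.L : ℝ) ^ (K - n)) ^ 3 / (a * c₁)))))
          * (Real.sqrt 3 * (eta F n K)⁻¹ * (Real.exp (μ' * eta F n K) - 1) + (Real.sqrt 3 * (eta F n K)⁻¹ * (Real.exp (μ' * eta F n K) - 1)) ^ 2 + Real.sqrt a * CT * (Real.exp (3 * μ') - 1) + a * CT ^ 2 * (Real.exp (3 * μ') - 1) ^ 2)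
          * (8 * Real.sqrt (max 2 (16 * c₀ * ((F.L : ℝ) ^ (K - n)) ^ 3 / (a * c₁))) + 8 * Real.sqrt (max 2 (16 * c₀ * ((F.L : ℝ) ^ (K - n)) ^ 3 / (a * c₁))) ^ 2)
          * (CT * (1 + (Real.exp (3 * μ') - 1))) + CG * (CT * (Real.exp (3 * μ') - 1))) ^ 2)⁻¹ * Real.exp (9 * μ')) * (c₀ * (Real.sqrt c₁)⁻¹ * Cpt * (((((F.P K).L : ℝ) ^ (F.P K).d) ^ (K - n)) * (2 * (1 + 1 / κ)) ^ 3) * Vb)) * ∑ i' : Site (F.P n) 0 × (Fin 2 × Fin 2), Real.exp (-(μ' * (Site.tdist (P := F.P K) (siteShift (sites_eq F n K h) i.1) (siteShift (sites_eq F n K h) i'.1) : ℝ)))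
      ≤ (((mB ^ 2 / 2 - 3 * ((Real.sqrt (max 2 (16 * c₀ * ((F.L : ℝ) ^ (K - n)) ^ 3 / (a * c₁))) * (2 + Real.sqrt (max 2 (16 * c₀ * ((F.L : ℝ) ^ (K - n)) ^ 3 / (a * c₁)))))
          * (Real.sqrt 3 * (eta F n K)⁻¹ * (Real.exp (μ' * eta F n K) - 1) + (Real.sqrt 3 * (eta F n K)⁻¹ * (Real.exp (μ' * eta F n K) - 1)) ^ 2 + Real.sqrt a * CT * (Real.exp (3 * μ') - 1) + a * CT ^ 2 * (Real.exp (3 * μ') - 1) ^ 2)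
          * (8 * Real.sqrt (max 2 (16 * c₀ * ((F.L : ℝ) ^ (K - n)) ^ 3 / (a * c₁))) + 8 * Real.sqrt (max 2 (16 * c₀ * ((F.L : ℝ) ^ (K - n)) ^ 3 / (a * c₁))) ^ 2)
          * (CT * (1 + (Real.exp (3 * μ') - 1))) + CG * (CT * (Real.exp (3 * μ') - 1))) ^ 2)⁻¹ * Real.exp (9 * μ')) * (c₀ * (Real.sqrt c₁)⁻¹ * Cpt * (((((F.P K).L : ℝ) ^ (F.P K).d) ^ (K - n)) * (2 * (1 + 1 / κ)) ^ 3) * Vb)) * (4 * (2 * (1 + 1 / μ')) ^ 3) := mul_le_mul_of_nonneg_left hS (mul_nonneg hCN0 hB0)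
    _ = _ := by ring

/-! ## §4 The lift of a coarse field is block-local and pointwise small -/

include hε₀ hε7 hreg hseq hι hT in
/-- ★★ **THE LIFT OF A COARSE COEFFICIENT FIELD, POINTWISE**: for ANY coefficients with `‖coef i‖ ≤ Cc`, `‖(T(Σ_i coef i • b i))(x)‖_{W₂} ≤ 4·A_T·Cc` — only the four spikes of the block of `x`
survive (✓`spike_column_source_eq_zero_off_block`), each of size `≤ A_T = (5∕4)√(2c₁)ℓ⁻³∕c₀·(√(2c₁)(√c₁)⁻¹)` (V2b ✓`norm_equiv_column_source_le`, V5 ✓`norm_spikeEntry_le`).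
[cite: Balaban1985BackgroundPropagators, (3.16) p.393, (3.21)–(3.25) p.394] -/
theorem norm_equiv_lift_coeffSum_apply_le (coef : Site (F.P n) 0 × (Fin 2 × Fin 2) → ℂ) {Cc : ℝ} (hcoef : ∀ i, ‖coef i‖ ≤ Cc) (x : Site (F.P K) 0) :
    ‖WL2.equiv ℂ _ W₂ (T (∑ i, coef i • (OrthonormalBasis.mk (orthonormal_spike F) (top_le_span_spike F) : OrthonormalBasis (Site (F.P n) 0 × (Fin 2 × Fin 2)) ℂ (SiteL2K ℂ 3 (periodsT3 F n) c₁ W₂)) i)) (siteEquiv F K x)‖ ≤ 4 * ((5 / 4) * Real.sqrt (2 * c₁) * ((((F.P K).L : ℝ) ^ (F.P K).d) ^ (K - n))⁻¹ / c₀ * (Real.sqrt (2 * c₁) * (Real.sqrt c₁)⁻¹)) * Cc := by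
  classical
  have hc₀ : 0 < c₀ := Fact.out
  have hCc : 0 ≤ Cc := (norm_nonneg _).trans (hcoef ((0 : Site (F.P n) 0), ((0 : Fin 2), (0 : Fin 2))))
  -- push `T` and the evaluation through the sum
  have hsum : WL2.equiv ℂ _ W₂ (T (∑ i, coef i • (OrthonormalBasis.mk (orthonormal_spike F) (top_le_span_spike F) : OrthonormalBasis (Site (F.P n) 0 × (Fin 2 × Fin 2)) ℂ (SiteL2K ℂ 3 (periodsT3 F n) c₁ W₂)) i)) (siteEquiv F K x)
      = ∑ i, coef i • WL2.equiv ℂ _ W₂ (T ((OrthonormalBasis.mk (orthonormal_spike F) (top_le_span_spike F) : OrthonormalBasis (Site (F.P n) 0 × (Fin 2 × Fin 2)) ℂ (SiteL2K ℂ 3 (periodsT3 F n) c₁ W₂)) i)) (siteEquiv F K x) := by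
    have e := congrFun (map_sum (WL2.linearEquiv ℂ ℂ (fun _ : TSite 3 (periodsT3 F K) => c₀) (V := W₂))
      (fun i => T (coef i • (OrthonormalBasis.mk (orthonormal_spike F) (top_le_span_spike F) : OrthonormalBasis (Site (F.P n) 0 × (Fin 2 × Fin 2)) ℂ (SiteL2K ℂ 3 (periodsT3 F n) c₁ W₂)) i)) Finset.univ) (siteEquiv F K x)
    simp only [WL2.linearEquiv_apply, Finset.sum_apply, map_smul, Pi.smul_apply] at e
    rw [map_sum]
    simpa only [map_smul] using e
  rw [hsum]
  -- only the block of `x` contributes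
  set s₀ : Site (F.P n) 0 := (siteShift (sites_eq F n K h)).symm (iterBlockOf (K - n) x) with hs₀
  have hoff : ∀ i : Site (F.P n) 0 × (Fin 2 × Fin 2), i.1 ≠ s₀ → WL2.equiv ℂ _ W₂ (T ((OrthonormalBasis.mk (orthonormal_spike F) (top_le_span_spike F) : OrthonormalBasis (Site (F.P n) 0 × (Fin 2 × Fin 2)) ℂ (SiteL2K ℂ 3 (periodsT3 F n) c₁ W₂)) i)) (siteEquiv F K x) = 0 := by
    intro i hi
    have hx : iterBlockOf (K - n) x ≠ siteShift (sites_eq F n K h) i.1 := by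
      intro hcontra
      apply hi
      rw [hs₀]
      exact ((Equiv.symm_apply_eq _).2 hcontra).symm
    have h0 := spike_column_source_eq_zero_off_block F h U₀ Q'' hseq ι hι T hT i x hx
    rw [toL2S_symm_apply] at h0
    rw [← (frobEquiv).symm_apply_apply (WL2.equiv ℂ _ W₂ (T ((OrthonormalBasis.mk (orthonormal_spike F) (top_le_span_spike F) : OrthonormalBasis (Site (F.P n) 0 × (Fin 2 × Fin 2)) ℂ (SiteL2K ℂ 3 (periodsT3 F n) c₁ W₂)) i)) (siteEquiv F K x)), h0, map_zero]
  rw [Fintype.sum_prod_type, Finset.sum_eq_single s₀]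
  rotate_left
  · intro s _ hs
    exact Finset.sum_eq_zero fun jk _ => by rw [hoff (s, jk) hs, smul_zero]
  · intro hs; exact absurd (Finset.mem_univ _) hs
  -- the four surviving terms
  refine (norm_sum_le _ _).trans ?_
  have hterm : ∀ jk : Fin 2 × Fin 2, ‖coef (s₀, jk) • WL2.equiv ℂ _ W₂ (T ((OrthonormalBasis.mk (orthonormal_spike F) (top_le_span_spike F) : OrthonormalBasis (Site (F.P n) 0 × (Fin 2 × Fin 2)) ℂ (SiteL2K ℂ 3 (periodsT3 F n) c₁ W₂)) (s₀, jk))) (siteEquiv F K x)‖ ≤ Cc * ((5 / 4) * Real.sqrt (2 * c₁) * ((((F.P K).L : ℝ) ^ (F.P K).d) ^ (K - n))⁻¹ / c₀ * (Real.sqrt (2 * c₁) * (Real.sqrt c₁)⁻¹)) := by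
    intro jk
    rw [norm_smul]
    refine mul_le_mul (hcoef _) ?_ (norm_nonneg _) hCc
    rw [spike_eq_lift F h ι hι (s₀, jk)]
    refine (norm_equiv_column_source_le F h hε₀ hε7 U₀ hreg Q'' hseq ι hι T hT _ _ _).trans ?_
    have hY := norm_spikeEntry_le (c₁ := c₁) jk.1 jk.2
    have hA0 : 0 ≤ (5 / 4) * Real.sqrt (2 * c₁) * ((((F.P K).L : ℝ) ^ (F.P K).d) ^ (K - n))⁻¹ / c₀ := by have := (F.P K).L_pos; positivity
    have h2 : 0 ≤ Real.sqrt (2 * c₁) := Real.sqrt_nonneg _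
    exact mul_le_mul_of_nonneg_left (mul_le_mul_of_nonneg_left hY h2) hA0
  calc ∑ jk : Fin 2 × Fin 2, ‖coef (s₀, jk) • WL2.equiv ℂ _ W₂ (T ((OrthonormalBasis.mk (orthonormal_spike F) (top_le_span_spike F) : OrthonormalBasis (Site (F.P n) 0 × (Fin 2 × Fin 2)) ℂ (SiteL2K ℂ 3 (periodsT3 F n) c₁ W₂)) (s₀, jk))) (siteEquiv F K x)‖
      ≤ ∑ _jk : Fin 2 × Fin 2, Cc * ((5 / 4) * Real.sqrt (2 * c₁) * ((((F.P K).L : ℝ) ^ (F.P K).d) ^ (K - n))⁻¹ / c₀ * (Real.sqrt (2 * c₁) * (Real.sqrt c₁)⁻¹)) := Finset.sum_le_sum fun jk _ => hterm jk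
    _ = 4 * ((5 / 4) * Real.sqrt (2 * c₁) * ((((F.P K).L : ℝ) ^ (F.P K).d) ^ (K - n))⁻¹ / c₀ * (Real.sqrt (2 * c₁) * (Real.sqrt c₁)⁻¹)) * Cc := by
        rw [Finset.sum_const, Finset.card_univ, Fintype.card_prod, Fintype.card_fin, nsmul_eq_mul]
        push_cast
        ring

/-! ## §5 ★★★ The source of `(1 − projR) v` is K-free small -/

include hε₀ hε7 hreg hseq hι hT ha hAG in
/-- ★★★ **THE SOURCE FORM OF PRINT'S COMPLEMENTARY PROJECTOR IS SUP-BOUNDED, K-FREE**: with `c(v) = Σ_i λ_i(v)•b i` (so that `(1 − projR)v = G(T c(v))`, §1), at every fine site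
`‖(T c(v))(x)‖_{W₂} ≤ 4·A_T·C_N(μ′)·4(2(1+1∕μ′))³·c₀(√c₁)⁻¹C_pt·ℓ³(2(1+1∕κ))³·sup‖v‖` — §4 ∘ §3; `A_T·c₀(√c₁)⁻¹ℓ³ = 5∕2` exactly, so the constant is K-FREE for every `c₁` (no pin needed).
This is LOCATE-hPcol v2 §2's brick P3v: `D R_S G′ᴾ g = D G_a(g′ − T c(G_a g′))`, `g′ = (1 − P₀)g`. [cite: Balaban1985BackgroundPropagators, Thm 3.1 (3.42)∕(3.46) pp.397–398, (3.49) p.399; Balaban1985Variational, (139) p.299] -/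
theorem norm_equiv_complementary_source_apply_le {μ' : ℝ} (hμ' : 0 < μ')
    {δ₁ : ℝ} (hδ₁ : 0 ≤ δ₁)
    (hδ : 3 * ((eta F n K)⁻¹) ^ 2 * (Real.exp (μ' * eta F n K) - 1) ^ 2 + a * ((25 / 8) * (c₁ * ((((F.P K).L : ℝ) ^ (F.P K).d) ^ (K - n))⁻¹ / c₀)) * (Real.exp (3 * μ') - 1) ^ 2 ≤ δ₁ ^ 2)
    (hwin : Real.sqrt (max 2 (16 * c₀ * ((F.L : ℝ) ^ (K - n)) ^ 3 / (a * c₁))) * δ₁ ≤ 1 / 10)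
    {CT : ℝ} (hCT : 0 ≤ CT) (hCTb : ∀ l : SiteL2K ℂ 3 (periodsT3 F K) c₀ W₂, ‖ι (Q'' l)‖ ≤ CT * ‖l‖)
    {CG : ℝ} (hCG : 0 ≤ CG) (hGn : ∀ f, ‖G f‖ ≤ CG * ‖f‖)
    {mB : ℝ} (hmB : 0 < mB) (hcoer : ∀ f : SiteL2K ℂ 3 (periodsT3 F n) c₁ W₂, mB * ‖f‖ ≤ ‖G (T f)‖)
    (hgap : 3 * ((Real.sqrt (max 2 (16 * c₀ * ((F.L : ℝ) ^ (K - n)) ^ 3 / (a * c₁))) * (2 + Real.sqrt (max 2 (16 * c₀ * ((F.L : ℝ) ^ (K - n)) ^ 3 / (a * c₁)))))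
          * (Real.sqrt 3 * (eta F n K)⁻¹ * (Real.exp (μ' * eta F n K) - 1) + (Real.sqrt 3 * (eta F n K)⁻¹ * (Real.exp (μ' * eta F n K) - 1)) ^ 2 + Real.sqrt a * CT * (Real.exp (3 * μ') - 1) + a * CT ^ 2 * (Real.exp (3 * μ') - 1) ^ 2)
          * (8 * Real.sqrt (max 2 (16 * c₀ * ((F.L : ℝ) ^ (K - n)) ^ 3 / (a * c₁))) + 8 * Real.sqrt (max 2 (16 * c₀ * ((F.L : ℝ) ^ (K - n)) ^ 3 / (a * c₁))) ^ 2)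
          * (CT * (1 + (Real.exp (3 * μ') - 1))) + CG * (CT * (Real.exp (3 * μ') - 1))) ^ 2 < mB ^ 2 / 2)
    {Cpt κ : ℝ} (hCpt : 0 ≤ Cpt) (hκ : 0 < κ)
    (hcol : ∀ (y : Site (F.P K) (K - n)) (Y : Matrix (Fin 2) (Fin 2) ℂ) (x : Site (F.P K) 0),
      ‖WL2.equiv ℂ _ W₂ (G (T (ι (Pi.single y Y)))) (siteEquiv F K x)‖ ≤ Cpt * Real.exp (-(κ * (Site.tdist (P := F.P K) (iterBlockOf (K - n) x) y : ℝ))) * ‖Y‖)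
    (v : SiteL2K ℂ 3 (periodsT3 F K) c₀ W₂) {Vb : ℝ} (hv : ∀ x : Site (F.P K) 0, ‖WL2.equiv ℂ _ W₂ v (siteEquiv F K x)‖ ≤ Vb) (x : Site (F.P K) 0) :
    ‖WL2.equiv ℂ _ W₂ (T (∑ i, (∑ i', (Matrix.of fun i i' : Site (F.P n) 0 × (Fin 2 × Fin 2) => ⟪G (T ((OrthonormalBasis.mk (orthonormal_spike F) (top_le_span_spike F) : OrthonormalBasis (Site (F.P n) 0 × (Fin 2 × Fin 2)) ℂ (SiteL2K ℂ 3 (periodsT3 F n) c₁ W₂)) i)), G (T ((OrthonormalBasis.mk (orthonormal_spike F) (top_le_span_spike F) : OrthonormalBasis (Site (F.P n) 0 × (Fin 2 × Fin 2)) ℂ (SiteL2K ℂ 3 (periodsT3 F n) c₁ W₂)) i'))⟫_ℂ)⁻¹ i i' * ⟪G (T ((OrthonormalBasis.mk (orthonormal_spike F) (top_le_span_spike F) : OrthonormalBasis (Site (F.P n) 0 × (Fin 2 × Fin 2)) ℂ (SiteL2K ℂ 3 (periodsT3 F n) c₁ W₂)) i')), v⟫_ℂ) • (OrthonormalBasis.mk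 (orthonormal_spike F) (top_le_span_spike F) : OrthonormalBasis (Site (F.P n) 0 × (Fin 2 × Fin 2)) ℂ (SiteL2K ℂ 3 (periodsT3 F n) c₁ W₂)) i)) (siteEquiv F K x)‖
      ≤ 4 * ((5 / 4) * Real.sqrt (2 * c₁) * ((((F.P K).L : ℝ) ^ (F.P K).d) ^ (K - n))⁻¹ / c₀ * (Real.sqrt (2 * c₁) * (Real.sqrt c₁)⁻¹)) * (((mB ^ 2 / 2 - 3 * ((Real.sqrt (max 2 (16 * c₀ * ((F.L : ℝ) ^ (K - n)) ^ 3 / (a * c₁))) * (2 + Real.sqrt (max 2 (16 * c₀ * ((F.L : ℝ) ^ (K - n)) ^ 3 / (a * c₁)))))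
          * (Real.sqrt 3 * (eta F n K)⁻¹ * (Real.exp (μ' * eta F n K) - 1) + (Real.sqrt 3 * (eta F n K)⁻¹ * (Real.exp (μ' * eta F n K) - 1)) ^ 2 + Real.sqrt a * CT * (Real.exp (3 * μ') - 1) + a * CT ^ 2 * (Real.exp (3 * μ') - 1) ^ 2)
          * (8 * Real.sqrt (max 2 (16 * c₀ * ((F.L : ℝ) ^ (K - n)) ^ 3 / (a * c₁))) + 8 * Real.sqrt (max 2 (16 * c₀ * ((F.L : ℝ) ^ (K - n)) ^ 3 / (a * c₁))) ^ 2)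
          * (CT * (1 + (Real.exp (3 * μ') - 1))) + CG * (CT * (Real.exp (3 * μ') - 1))) ^ 2)⁻¹ * Real.exp (9 * μ')) * (4 * (2 * (1 + 1 / μ')) ^ 3) * (c₀ * (Real.sqrt c₁)⁻¹ * Cpt * (((((F.P K).L : ℝ) ^ (F.P K).d) ^ (K - n)) * (2 * (1 + 1 / κ)) ^ 3) * Vb)) :=
  norm_equiv_lift_coeffSum_apply_le F h hε₀ hε7 U₀ hreg Q'' hseq ι hι T hT (fun i => (∑ i', (Matrix.of fun i i' : Site (F.P n) 0 × (Fin 2 × Fin 2) => ⟪G (T ((OrthonormalBasis.mk (orthonormal_spike F) (top_le_span_spike F) : OrthonormalBasis (Site (F.P n) 0 × (Fin 2 × Fin 2)) ℂ (SiteL2K ℂ 3 (periodsT3 F n) c₁ W₂)) i)), G (T ((OrthonormalBasis.mk (orthonormal_spike F) (top_le_span_spike F) : OrthonormalBasis (Site (F.P n) 0 × (Fin 2 × Fin 2)) ℂ (SiteL2K ℂ 3 (periodsT3 F n) c₁ W₂)) i'))⟫_ℂ)⁻¹ i i' * ⟪G (T ((OrthonormalBasis.mk (orthonormal_spike F) (top_le_span_spike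 F) : OrthonormalBasis (Site (F.P n) 0 × (Fin 2 × Fin 2)) ℂ (SiteL2K ℂ 3 (periodsT3 F n) c₁ W₂)) i')), v⟫_ℂ))
    (fun i => norm_coeff_le_of_sup F h hε₀ hε7 U₀ hreg Q'' hseq ι hι T hT ha G hAG hμ' hδ₁ hδ hwin hCT hCTb hCG hGn hmB hcoer hgap hCpt hκ hcol v hv i) x

end Summit.QuantumFields.YangMills.Theorems.Prop7ComplementaryProjectorSourceForm

end
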